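import Literature.Computability.MetaComplexity.TseitinDepthFregeSubdivision
import Literature.Computability.MetaComplexity.TseitinDepthFregeTransfer
import HarnessLib

/-!
# The Galesi–Itsykson–Riazanov–Sofronova treewidth lower bound, conditionally

`Literature.Computability.MetaComplexity.galesiEtAl_tseitin_treewidth_depthFrege_lowerBound`
(`TseitinDepthFrege.lean`; GIRS, APAL 2023, Thm. 18 = MFCS 2019, Thm. 17) is proved in the source
from two deep inputs that the tree does not have and that are far beyond an inline proof:

* (H) **Håstad's grid theorem** (GIRS Thm. 17, citing J. Håstad, *On small-depth Frege proofs for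
  Tseitin for grids*, FOCS 2017 / JACM 68 (2021), Thm. 6.5): there is `K > 0` such that for
  `d ≤ K log n / log log n` every depth-`d` Frege refutation of the Tseitin formula of the grid
  `𝓗_{n,n}` has size `2^{n^{Ω(1/d)}}` — a multi-switching lemma argument of some thirty pages;
* (W) **the polynomial excluded-grid theorem in wall form** (GIRS Cor. 9, from Thm. 8 =
  Chuzhoy–Tan, JCTB 146 (2021), Thm. 1.1 with `λ ≥ 1/10`): a graph of treewidth `t ≥ t₁` contains the
  wall `W_r` as a topological minor for some `r ≥ c · t^{1/10}`.

This file proves the **reduction** of the source (its §3, Lemmas 10–16, and §3.3) completely and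
states the GIRS bound *conditionally* on (H) and (W), spelled out as explicit hypotheses in the
tree's vocabulary (`IsGridTseitinSystem`, `wall`, `≼ₜ`):
`galesiEtAl_tseitin_treewidth_depthFrege_lowerBound_of_hastad_of_wall`. The combinatorial and
proof-theoretic groundwork is in the sibling files `TseitinDepthFregeTransfer.lean` (Lemma 10:
transfer of a refutation along a substitution, by truth-table derivations),
`TseitinDepthFregeBricks.lean` (the brick graph `bricks k ⊆ W_{3k+3}`, which contracts to `𝓗_{k,k}`;
the grid Tseitin system `gridSystem`) and `TseitinDepthFregeSubdivision.lean` (Lemma 11 and the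
composed substitution `σ` of Lemmas 12–16 with its four row equations). Here:

1. **The reduction step** (`exists_gridRefutation`): if the row graph `G` of a graph Tseitin system
   `E` contains a subdivision of `bricks k` (`BrickEmbedding k G`), a depth-`d` `textbookFrege`
   refutation of `sumEncoding 1 E` of size `S` yields a depth-`(d + 23)` refutation of the Tseitin
   formula `sumEncoding 1 (gridSystem k f)` of `𝓗_{k,k}` (suitable charges `f`) of size at most
   `2^78 (S + (k+1)^2 + 1)^3`. The printed chain "restriction (L. 12) → suppressions (L. 13–15) →
   contraction of the matching (L. 16) → restriction to the sub-grid (L. 12)" is realised by the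
   ONE substitution `σ` followed by ONE application of the transfer lemma; this file checks its
   hypothesis (`BrickEmbedding.transfer_hloc`): every substituted parity block of `T(G, f)` is a
   tautology (rows off the subdivision, suppressed rows, left branch rows) or is implied by the
   `≤ 16` clauses of one parity block of the grid formula over the same `≤ 4` variables (right
   branch rows), and does the size bookkeeping.
2. **§3.3** ("for some constants … `S^c ≥ 2^{⌊(r-1)/2⌋^{Ω(1/(d+C))}}`, hence `S ≥ 2^{t^{Ω(1/d)}}`"):
   the elementary real analysis with all thresholds explicit (`TseitinNumerics`), and the assembly
   from (H) and (W) with `c := c_H / 480`, grid side `k = ⌊(r-3)/3⌋`, depth `d + 23`.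
3. **The same assembly on the weakest usable forms of the inputs**
   (`galesiEtAl_tseitin_treewidth_depthFrege_lowerBound_of_grid_of_wall`): (H′) the grid case of
   the bound depth by depth (`∃ c > 0, ∀ d, ∃ n₁, ∀ n ≥ n₁`, size `≥ 2^{n^{c/d}}` on `𝓗_{n,n}`; implied
   by (H), `gridBound_of_hastadForm`) and (W_δ) the wall form with ANY exponent `δ > 0` in place
   of `1/10` (`wallForm_anyExponent_of_tenth`); then `c := c_{H′} δ / 48`. So any polynomial
   excluded-grid theorem and any proof of the grid case discharge the GIRS bound through this file.

All statements are proved; no new facts.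

## References

* [GalesiEtAl2023] N. Galesi, D. Itsykson, A. Riazanov, A. Sofronova, *Bounded-depth Frege
  complexity of Tseitin formulas for all graphs*, Ann. Pure Appl. Logic 174 (2023) 103166,
  Thm. 8, Cor. 9, §3.1 (Lemmas 10–12), §3.2 (Lemmas 13–16), Thm. 17, Thm. 18 and its proof
  (§3.3). Read: APAL text pp. 9–16.
* [Hastad2020] J. Håstad, *On small-depth Frege proofs for Tseitin for grids*, J. ACM 68 (2021),
  Thm. 6.5 (read: ECCC TR17-142, p. 19).
* [ChuzhoyTan2021] J. Chuzhoy, Z. Tan, *Towards tight(er) bounds for the excluded grid theorem*,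
  J. Combin. Theory Ser. B 146 (2021), Thm. 1.1 (read: arXiv:1901.07944, p. 3).
-/

namespace Literature.Computability.MetaComplexity

open Finset Literature.Combinatorics.SimpleGraph Bricks Complexity Complexity.PropForm TextbookFrege

/-! ### Clause formulas: semantics and variables -/

/-- The formula of a literal has the value of the literal. [folklore] -/
theorem eval_litOf (σ : ℕ → Bool) (l : Literal ℕ) : (KrajicekRamsey.litOf l).eval σ = l.eval σ := by
  unfold KrajicekRamsey.litOf Literal.eval
  rcases l with ⟨x, b⟩
  cases b <;> cases h : σ x <;> simp [PropForm.eval, h]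

/-- The formula of a clause has the value of the clause. [folklore] -/
theorem eval_clauseOf (σ : ℕ → Bool) (c : Clause ℕ) : (KrajicekRamsey.clauseOf c).eval σ = c.eval σ := by
  induction c with
  | nil => rfl
  | cons l c ih =>
    have e : KrajicekRamsey.clauseOf (l :: c) = disj (KrajicekRamsey.litOf l) (KrajicekRamsey.clauseOf c) := rfl
    rw [e, PropForm.eval, ih, eval_litOf]
    rfl

/-- The variables of the formula of a clause are the variables of its literals. [folklore] -/
theorem mem_vars_clauseOf {c : Clause ℕ} {x : ℕ} (h : x ∈ (KrajicekRamsey.clauseOf c).vars) : ∃ l ∈ c, l.1 = x := by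
  induction c with
  | nil => simp [KrajicekRamsey.clauseOf, PropForm.vars] at h
  | cons l c ih =>
    have e : KrajicekRamsey.clauseOf (l :: c) = disj (KrajicekRamsey.litOf l) (KrajicekRamsey.clauseOf c) := rfl
    rw [e] at h
    simp only [PropForm.vars, Finset.mem_union] at h
    rcases h with h | h
    · refine ⟨l, by simp, ?_⟩
      unfold KrajicekRamsey.litOf at h
      split_ifs at h <;> simp only [PropForm.vars, Finset.mem_singleton] at h <;> exact h.symm
    · obtain ⟨l', hl', rfl⟩ := ih h
      exact ⟨l', by simp [hl'], rfl⟩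

/-- A block of one Boolean variable: `encBlock 1 i = [i]`. [folklore] -/
theorem encBlock_one (i : ℕ) : encBlock 1 i = [i] := by
  show (List.range 1).map _ = _
  have h : List.range 1 = [0] := rfl
  rw [h]
  simp

/-- With blocks of size one, the block value of `σ` at `j` is `[σ j]`. [folklore] -/
theorem blockVals_one (p n : ℕ) (σ : ℕ → Bool) (j : Fin n) :
    blockVals p 1 n σ j = if σ j then 1 else 0 := by
  simp only [blockVals, blockVal, encBlock_one, List.filter_cons, List.filter_nil]
  cases σ j <;> simp

/-- A canonical parity block has at most `2^{(#supp)·B}` clauses. [folklore] -/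
theorem length_equationCNF_le {p n : ℕ} (Bk : ℕ) (e : LinEqMod p n) :
    (equationCNF Bk e).length ≤ 2 ^ (e.supp.card * Bk) := by
  rw [equationCNF, canonicalCNF, List.length_map, ← length_eqVars Bk e, ← List.length_sublists]
  exact List.length_filter_le _ _

/-- Length of a `flatMap` with uniformly bounded pieces. [folklore] -/
theorem length_flatMap_le {ι β : Type*} {l : List ι} {g : ι → List β} {b : ℕ}
    (h : ∀ a ∈ l, (g a).length ≤ b) : (l.flatMap g).length ≤ l.length * b := by
  induction l with
  | nil => simp
  | cons a l ih =>
    rw [List.flatMap_cons, List.length_append, List.length_cons, Nat.succ_mul]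
    have h1 := h a (by simp)
    have h2 := ih fun x hx => h x (by simp [hx])
    omega

/-! ### The grid Tseitin system: coefficients, rows, semantics -/

/-- At most two grid edges enter the right copy of a cell (one horizontal, one vertical).
[cite: GalesiEtAl2023, Lemma 16 ("all degrees in M_n are at most 4")] -/
theorem card_rightEdges_le {k : ℕ} (w : Fin (k + 1) × Fin (k + 1)) : (rightEdges w).card ≤ 2 := by
  have h : Set.InjOn (fun ε : GridEdge k => ε.isLeft) ↑(rightEdges w) := by
    rintro (⟨i, c⟩ | ⟨i, c⟩) hε (⟨i', c'⟩ | ⟨i', c'⟩) hε' heq <;>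
      simp only [rightEdges, Finset.coe_filter, Set.mem_setOf_eq, Finset.mem_univ, true_and,
        gridEnds_inl, gridEnds_inr, Sum.isLeft_inl, Sum.isLeft_inr, Bool.false_eq_true,
        Bool.true_eq_false] at hε hε' heq
    · rw [← hε'] at hε
      simp only [Prod.mk.injEq] at hε
      rw [hε.1, Fin.castSucc_inj.1 hε.2]
    · rw [← hε'] at hε
      simp only [Prod.mk.injEq] at hε
      rw [Fin.succ_inj.1 hε.1, hε.2]
  calc (rightEdges w).card ≤ (Finset.univ : Finset Bool).card :=
        Finset.card_le_card_of_injOn _ (fun _ _ => Finset.mem_univ _) h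
    _ = 2 := rfl

/-- The coefficient of the variable of the grid edge `ε` in the row of the cell `w`: the number of
ends of `ε` equal to `w`. [cite: GalesiEtAl2023, §2 (Tseitin formulas; grids)] -/
theorem gridSystem_coeff (k : ℕ) (f : Fin (k + 1) × Fin (k + 1) → ZMod 2) (w : Fin (k + 1) × Fin (k + 1))
    (ε : GridEdge k) :
    (gridSystem k f (Fintype.equivFin _ w)).1 (Fintype.equivFin _ ε) =
      (if (gridEnds ε).1 = w then 1 else 0) + (if (gridEnds ε).2 = w then 1 else 0) := by
  simp only [gridSystem, Equiv.symm_apply_apply]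
  have hne := gridEnds_fst_ne_snd ε
  by_cases h1 : (gridEnds ε).1 = w <;> by_cases h2 : (gridEnds ε).2 = w
  · exact absurd (h1.trans h2.symm) hne
  · rw [if_pos (Or.inl h1.symm), if_pos h1, if_neg h2, add_zero]
  · rw [if_pos (Or.inr h2.symm), if_neg h1, if_pos h2, zero_add]
  · rw [if_neg, if_neg h1, if_neg h2, add_zero]
    rintro (h | h)
    · exact h1 h.symm
    · exact h2 h.symm

/-- The left-hand side of the row of the cell `w`: the sum of the values of the edges entering
the left copy and of those entering the right copy of `w`. [folklore] -/
theorem gridSystem_rowSum (k : ℕ) (f : Fin (k + 1) × Fin (k + 1) → ZMod 2) (w : Fin (k + 1) × Fin (k + 1))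
    (z : Fin (Fintype.card (GridEdge k)) → ZMod 2) :
    ∑ j, (gridSystem k f (Fintype.equivFin _ w)).1 j * z j =
      ∑ ε ∈ leftEdges w, z (Fintype.equivFin _ ε) + ∑ ε ∈ rightEdges w, z (Fintype.equivFin _ ε) := by
  rw [← Equiv.sum_comp (Fintype.equivFin (GridEdge k))]
  simp only [gridSystem_coeff, add_mul, ite_mul, one_mul, zero_mul, Finset.sum_add_distrib]
  rw [leftEdges, rightEdges, Finset.sum_filter, Finset.sum_filter]

/-- The support of a grid row has at most four variables. [cite: GalesiEtAl2023, Lemma 16 ("all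
degrees in M_n are at most 4")] -/
theorem supp_gridSystem_card_le (k : ℕ) (f : Fin (k + 1) × Fin (k + 1) → ZMod 2) (i) :
    (gridSystem k f i).supp.card ≤ 4 := by
  classical
  obtain ⟨w, rfl⟩ : ∃ w, i = Fintype.equivFin _ w := ⟨(Fintype.equivFin _).symm i, by simp⟩
  have hsub : (gridSystem k f (Fintype.equivFin _ w)).supp ⊆
      (leftEdges w ∪ rightEdges w).map (Fintype.equivFin (GridEdge k)).toEmbedding := by
    intro j hj
    have hcoef := (Finset.mem_filter.1 hj).2
    obtain ⟨ε, rfl⟩ : ∃ ε, j = Fintype.equivFin _ ε := ⟨(Fintype.equivFin _).symm j, by simp⟩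
    rw [gridSystem_coeff] at hcoef
    rw [Finset.mem_map]
    refine ⟨ε, ?_, rfl⟩
    rw [Finset.mem_union, leftEdges, rightEdges, Finset.mem_filter, Finset.mem_filter]
    by_cases h1 : (gridEnds ε).1 = w
    · exact Or.inl ⟨Finset.mem_univ _, h1⟩
    · by_cases h2 : (gridEnds ε).2 = w
      · exact Or.inr ⟨Finset.mem_univ _, h2⟩
      · exfalso; apply hcoef; rw [if_neg h1, if_neg h2, add_zero]
  calc _ ≤ ((leftEdges w ∪ rightEdges w).map (Fintype.equivFin (GridEdge k)).toEmbedding).card :=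
        Finset.card_le_card hsub
    _ ≤ (leftEdges w).card + (rightEdges w).card := by
        rw [Finset.card_map]; exact Finset.card_union_le _ _
    _ ≤ 4 := by have := card_leftEdges_le w; have := card_rightEdges_le w; omega

/-- **Semantics of a grid parity block**: the row of the cell `w` holds for the block values of
`τ` iff the `𝔽₂`-values of the grid variables at `w` sum to the charge `f w`. [folklore] -/
theorem gridSystem_holds_iff (k : ℕ) (f : Fin (k + 1) × Fin (k + 1) → ZMod 2) (w : Fin (k + 1) × Fin (k + 1))
    (τ : ℕ → Bool) :
    (gridSystem k f (Fintype.equivFin _ w)).Holds (blockVals 2 1 _ τ) ↔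
      ∑ ε ∈ leftEdges w, BrickEmbedding.yv τ ε + ∑ ε ∈ rightEdges w, BrickEmbedding.yv τ ε = f w := by
  unfold LinEqMod.Holds
  rw [gridSystem_rowSum, gridSystem_snd, Equiv.symm_apply_apply]
  simp only [blockVals_one]
  rfl

/-- The clause formulas of a grid Tseitin formula have total size `≤ 224 (k+1)^2`. [folklore] -/
theorem msum_gridEncoding_le (k : ℕ) (f : Fin (k + 1) × Fin (k + 1) → ZMod 2) :
    msum ((sumEncoding 1 (gridSystem k f)).map KrajicekRamsey.clauseOf) ≤ 224 * (k + 1) ^ 2 := by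
  have hlen : (sumEncoding 1 (gridSystem k f)).length ≤ (k + 1) ^ 2 * 16 := by
    unfold sumEncoding
    refine (length_flatMap_le (b := 16) fun i _ => ?_).trans ?_
    · calc (equationCNF 1 (gridSystem k f i)).length ≤ 2 ^ ((gridSystem k f i).supp.card * 1) :=
            length_equationCNF_le 1 _
        _ ≤ 2 ^ 4 := Nat.pow_le_pow_right (by norm_num)
            (by rw [Nat.mul_one]; exact supp_gridSystem_card_le k f i)
        _ = 16 := by norm_num
    · rw [List.length_finRange, Fintype.card_prod, Fintype.card_fin, pow_two]
  have hW : ∀ X ∈ (sumEncoding 1 (gridSystem k f)).map KrajicekRamsey.clauseOf, X.size + 1 ≤ 14 := by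
    intro X hX
    obtain ⟨C, hC, rfl⟩ := List.mem_map.1 hX
    simp only [sumEncoding, List.mem_flatMap, List.mem_finRange, true_and] at hC
    obtain ⟨i, hC⟩ := hC
    have hClen : C.length ≤ 4 := by
      rw [length_of_mem_canonicalCNF hC, length_eqVars, Nat.mul_one]
      exact supp_gridSystem_card_le k f i
    have hs : (KrajicekRamsey.clauseOf C).size = msum (C.map KrajicekRamsey.litOf) + 1 := by
      rw [KrajicekRamsey.clauseOf, size_disjList_eq_msum]
    have hm : msum (C.map KrajicekRamsey.litOf) ≤ (C.map KrajicekRamsey.litOf).length * 3 :=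
      msum_le_length_mul fun X hX => by
        obtain ⟨l, -, rfl⟩ := List.mem_map.1 hX
        unfold KrajicekRamsey.litOf; split_ifs <;> simp [PropForm.size]
    rw [List.length_map] at hm
    omega
  calc msum _ ≤ ((sumEncoding 1 (gridSystem k f)).map KrajicekRamsey.clauseOf).length * 14 := msum_le_length_mul hW
    _ ≤ ((k + 1) ^ 2 * 16) * 14 := by rw [List.length_map]; exact Nat.mul_le_mul_right _ hlen
    _ = 224 * (k + 1) ^ 2 := by ring

/-! ### The substitution: size and depth -/

namespace BrickEmbedding

variable {n m k : ℕ} {E : Fin m → LinEqMod 2 n} {G : SimpleGraph (Fin m)} (B : BrickEmbedding k G)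
  (hE : IsGraphSystem E G) (α : Fin n → Bool)

/-- The base formulas have size `≤ 28`. [cite: GalesiEtAl2023, Lemma 16 ("the size of τ_e is O(1)")] -/
theorem size_baseForm_le (e : BEdge k) : (B.baseForm hE α e).size ≤ 28 := by
  rcases e with w | ε
  · have h := size_xorForm_le (decide (B.chL hE α w = 1)) ((leftEdges w).toList.map (gi k))
    have hl : ((leftEdges w).toList.map (gi k)).length ≤ 2 := by
      rw [List.length_map, Finset.length_toList]; exact card_leftEdges_le w
    have : 2 ^ ((leftEdges w).toList.map (gi k)).length ≤ 2 ^ 2 := Nat.pow_le_pow_right (by norm_num) hl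
    show (xorForm _ _).size ≤ 28
    omega
  · show (PropForm.var _).size ≤ 28
    simp [PropForm.size]

/-- The base formulas have auxiliary depths `≤ 6`. [folklore] -/
theorem altDepthAux_baseForm_le (e : BEdge k) (c : ℕ) : altDepthAux c (B.baseForm hE α e) ≤ 6 := by
  rcases e with w | ε
  · have h := altDepthAux_xorForm_le (decide (B.chL hE α w = 1)) ((leftEdges w).toList.map (gi k)) c
    have hl : ((leftEdges w).toList.map (gi k)).length ≤ 2 := by
      rw [List.length_map, Finset.length_toList]; exact card_leftEdges_le w
    show altDepthAux c (xorForm _ _) ≤ 6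
    omega
  · show altDepthAux c (PropForm.var _) ≤ 6
    simp [PropForm.altDepthAux]

/-- The substituted formulas have size `≤ 29`. [cite: GalesiEtAl2023, §3.2] -/
theorem size_subst_le (x : ℕ) : (B.subst hE α x).size ≤ 29 := by
  unfold BrickEmbedding.subst
  split_ifs with hx hon
  · exact (size_signForm_le _ _).trans (Nat.succ_le_succ (B.size_baseForm_le hE α _))
  · simp [PropForm.size]
  · simp [PropForm.size]

/-- The substituted formulas have auxiliary depths `≤ 7`. [cite: GalesiEtAl2023, §3.2] -/
theorem altDepthAux_subst_le_seven (x c : ℕ) : altDepthAux c (B.subst hE α x) ≤ 7 := by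
  unfold BrickEmbedding.subst
  split_ifs with hx hon
  · exact altDepthAux_signForm_le _ _ (fun c => B.altDepthAux_baseForm_le hE α _ c) c
  · simp [PropForm.altDepthAux]
  · simp [PropForm.altDepthAux]

/-! ### Substituted source blocks follow from the row equations -/

/-- A clause of the parity block of the row `r`, after the substitution, is true under `τ` as soon
as the row equation holds for the induced values. [folklore] -/
theorem substClause_eval {r : Fin m} {c : Clause ℕ} (hc : c ∈ equationCNF 1 (E r)) (τ : ℕ → Bool)
    (h : ∑ j, (E r).1 j * B.zval hE α τ j = (E r).2) :
    ((KrajicekRamsey.clauseOf c).subst (B.subst hE α)).eval τ = true := by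
  rw [eval_subst, eval_clauseOf]
  have hcnf : (equationCNF 1 (E r)).eval (fun x => (B.subst hE α x).eval τ) = true := by
    rw [eval_equationCNF]
    refine decide_eq_true ?_
    show ∑ j, (E r).1 j * blockVals 2 1 n _ j = (E r).2
    rw [← h]
    refine Finset.sum_congr rfl fun j _ => ?_
    rw [blockVals_one]
    rfl
  exact (CNF.eval_eq_true_iff _ _).1 hcnf c hc

/-- The variables of a substituted clause of the row `r` are variables of base formulas of brick
edges whose paths pass through `r`. [folklore] -/
theorem mem_vars_substClause {r : Fin m} {c : Clause ℕ} (hc : c ∈ equationCNF 1 (E r)) {x : ℕ}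
    (hx : x ∈ ((KrajicekRamsey.clauseOf c).subst (B.subst hE α)).vars) :
    ∃ e t, t < B.len e ∧ (r = B.row e t ∨ r = B.row e (t + 1)) ∧ x ∈ (B.baseForm hE α e).vars := by
  obtain ⟨y, hy, hxy⟩ := mem_vars_subst hx
  obtain ⟨l, hl, rfl⟩ := mem_vars_clauseOf hy
  have hl1 : l.1 ∈ eqVars 1 (E r) := fst_mem_of_mem_canonicalCNF hc hl
  obtain ⟨i, hi, hli⟩ := mem_eqVars.1 hl1
  rw [encBlock_one, List.mem_singleton] at hli
  rw [hli] at hxy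
  by_cases hon : B.OnPath hE i
  · obtain ⟨e, t, ht, rfl⟩ := hon
    rw [B.subst_pv hE α ht, vars_signForm] at hxy
    exact ⟨e, t, ht, (B.pv_mem_iff hE ht r).1 hi, hxy⟩
  · rw [B.subst_of_not_onPath hE α hon] at hxy
    simp [PropForm.vars] at hxy

/-- Variables of a base formula: grid variables of the edge itself (grid edge) or of the grid
edges entering the left copy of its cell (matching edge). [folklore] -/
theorem mem_vars_baseForm {e : BEdge k} {x : ℕ} (hx : x ∈ (B.baseForm hE α e).vars) :
    ∃ ε : GridEdge k, x = gi k ε ∧ (e = Sum.inr ε ∨ ∃ w, e = Sum.inl w ∧ ε ∈ leftEdges w) := by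
  rcases e with w | ε
  · have h : x ∈ (leftEdges w).toList.map (gi k) := mem_vars_xorForm hx
    obtain ⟨ε, hε, rfl⟩ := List.mem_map.1 h
    exact ⟨ε, rfl, Or.inr ⟨w, rfl, Finset.mem_toList.1 hε⟩⟩
  · refine ⟨ε, ?_, Or.inl rfl⟩
    simpa [BrickEmbedding.baseForm, PropForm.vars] using hx

/-! ### The hypothesis of the transfer lemma -/

/-- The variable budget at a cell: the grid variables entering its left copy, then those entering
its right copy (`≤ 4` variables). [folklore] -/
noncomputable def cellVars (k : ℕ) (w : Fin (k + 1) × Fin (k + 1)) : List ℕ :=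
  (leftEdges w).toList.map (gi k) ++ (rightEdges w).toList.map (gi k)

/-- `cellVars` is duplicate-free. [folklore] -/
theorem nodup_cellVars (k : ℕ) (w : Fin (k + 1) × Fin (k + 1)) : (cellVars k w).Nodup := by
  refine List.Nodup.append (((leftEdges w).nodup_toList).map (gi_injective k))
    (((rightEdges w).nodup_toList).map (gi_injective k)) ?_
  intro x hx hx'
  obtain ⟨ε, hε, rfl⟩ := List.mem_map.1 hx
  obtain ⟨ε', hε', hεε⟩ := List.mem_map.1 hx'
  have := gi_injective k hεε
  subst this
  rw [Finset.mem_toList, leftEdges, Finset.mem_filter] at hε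
  rw [Finset.mem_toList, rightEdges, Finset.mem_filter] at hε'
  exact gridEnds_fst_ne_snd _ (hε.2.trans hε'.2.symm)

/-- `cellVars` has at most four variables. [folklore] -/
theorem length_cellVars_le (k : ℕ) (w : Fin (k + 1) × Fin (k + 1)) : (cellVars k w).length ≤ 4 := by
  rw [cellVars, List.length_append, List.length_map, List.length_map, Finset.length_toList,
    Finset.length_toList]
  have := card_leftEdges_le w; have := card_rightEdges_le w; omega

/-- Grid variables entering the left copy of `w` are in `cellVars k w`. [folklore] -/
theorem gi_mem_cellVars_of_left {k : ℕ} {w : Fin (k + 1) × Fin (k + 1)} {ε : GridEdge k}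
    (h : ε ∈ leftEdges w) : gi k ε ∈ cellVars k w :=
  List.mem_append_left _ (List.mem_map.2 ⟨ε, Finset.mem_toList.2 h, rfl⟩)

/-- Grid variables entering the right copy of `w` are in `cellVars k w`. [folklore] -/
theorem gi_mem_cellVars_of_right {k : ℕ} {w : Fin (k + 1) × Fin (k + 1)} {ε : GridEdge k}
    (h : ε ∈ rightEdges w) : gi k ε ∈ cellVars k w :=
  List.mem_append_right _ (List.mem_map.2 ⟨ε, Finset.mem_toList.2 h, rfl⟩)

/-- **The local data for the transfer lemma** (GIRS §3.1–3.2 for the composed substitution).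
For every clause `c` of `T(G, f) = sumEncoding 1 E`, the substituted clause `c[σ]` mentions at
most `4` grid variables, and either it is a tautology (rows off the subdivision: Lemma 12 "`Par(v)[α]`
is identically true"; suppressed rows: Lemma 13 "`ψ_v[σ_v]` is a tautology"; left matching ends:
Lemma 16 "`ψ'_w` is identically true") or it follows from the `≤ 16` clauses of the parity block of
one grid vertex (right matching ends: Lemma 16 "`ψ'_w` is equivalent to the parity condition of the
merged vertex"), provided `α` satisfies every row off the subdivision (Lemma 11).
[cite: GalesiEtAl2023, Lemmas 11–16] -/
theorem transfer_hloc (hα : ∀ r, (∀ e, r ∉ (B.P e).support) → rowVal E α r = (E r).2)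
    {c : Clause ℕ} (hc : c ∈ sumEncoding 1 E) :
    ∃ (Lc : List (Clause ℕ)) (V : List ℕ),
      (∀ C ∈ Lc, C ∈ sumEncoding 1 (gridSystem k (B.charge hE α))) ∧ Lc.length ≤ 16 ∧ V.Nodup ∧
      V.length ≤ 4 ∧ (∀ x ∈ ((KrajicekRamsey.clauseOf c).subst (B.subst hE α)).vars, x ∈ V) ∧
      (∀ C ∈ Lc, ∀ x ∈ (KrajicekRamsey.clauseOf C).vars, x ∈ V) ∧
      ∀ τ : ℕ → Bool, (∀ C ∈ Lc, (KrajicekRamsey.clauseOf C).eval τ = true) →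
        ((KrajicekRamsey.clauseOf c).subst (B.subst hE α)).eval τ = true := by
  classical
  simp only [sumEncoding, List.mem_flatMap, List.mem_finRange, true_and] at hc
  obtain ⟨r, hc⟩ := hc
  -- a substituted clause all of whose assignments satisfy the row equation needs no grid clause
  have tautCase : ∀ V : List ℕ, V.Nodup → V.length ≤ 4 →
      (∀ x ∈ ((KrajicekRamsey.clauseOf c).subst (B.subst hE α)).vars, x ∈ V) →
      (∀ τ, ∑ j, (E r).1 j * B.zval hE α τ j = (E r).2) →
      ∃ (Lc : List (Clause ℕ)) (V : List ℕ),
        (∀ C ∈ Lc, C ∈ sumEncoding 1 (gridSystem k (B.charge hE α))) ∧ Lc.length ≤ 16 ∧ V.Nodup ∧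
        V.length ≤ 4 ∧ (∀ x ∈ ((KrajicekRamsey.clauseOf c).subst (B.subst hE α)).vars, x ∈ V) ∧
        (∀ C ∈ Lc, ∀ x ∈ (KrajicekRamsey.clauseOf C).vars, x ∈ V) ∧
        ∀ τ : ℕ → Bool, (∀ C ∈ Lc, (KrajicekRamsey.clauseOf C).eval τ = true) →
          ((KrajicekRamsey.clauseOf c).subst (B.subst hE α)).eval τ = true :=
    fun V h1 h2 h3 h4 => ⟨[], V, by simp, by simp, h1, h2, h3, by simp,
      fun τ _ => B.substClause_eval hE α hc τ (h4 τ)⟩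
  by_cases hR : ∃ w, r = B.f (w, true)
  · -- a right branch vertex: implied by the grid block of its cell
    obtain ⟨w, rfl⟩ := hR
    refine ⟨equationCNF 1 (gridSystem k (B.charge hE α) (Fintype.equivFin _ w)), cellVars k w,
      ?_, ?_, nodup_cellVars k w, length_cellVars_le k w, ?_, ?_, ?_⟩
    · intro C hC
      simp only [sumEncoding, List.mem_flatMap, List.mem_finRange, true_and]
      exact ⟨_, hC⟩
    · refine (length_equationCNF_le 1 _).trans ?_
      calc 2 ^ ((gridSystem k (B.charge hE α) (Fintype.equivFin _ w)).supp.card * 1) ≤ 2 ^ 4 :=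
            Nat.pow_le_pow_right (by norm_num) (by rw [Nat.mul_one]; exact supp_gridSystem_card_le k _ _)
        _ = 16 := by norm_num
    · intro x hx
      obtain ⟨e, t, ht, hr, hxe⟩ := B.mem_vars_substClause hE α hc hx
      have hsup : B.f (w, true) ∈ (B.P e).support := by
        rcases hr with hr | hr <;> rw [hr] <;> exact B.row_mem_support e _
      have hend : rend e = w := by
        rcases B.branch e _ hsup with h | h
        · simp at h
        · simp only [Prod.mk.injEq, and_true] at h; exact h.symm
      obtain ⟨ε, rfl, hε⟩ := B.mem_vars_baseForm hE α hxe
      rcases hε with rfl | ⟨w', rfl, hε⟩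
      · exact gi_mem_cellVars_of_right (by
          rw [rightEdges, Finset.mem_filter]; exact ⟨Finset.mem_univ _, hend⟩)
      · have hw : w' = w := hend
        subst hw
        exact gi_mem_cellVars_of_left hε
    · intro C hC x hx
      obtain ⟨l, hl, rfl⟩ := mem_vars_clauseOf hx
      have hl1 := fst_mem_of_mem_canonicalCNF hC hl
      obtain ⟨j, hj, hlj⟩ := mem_eqVars.1 hl1
      rw [encBlock_one, List.mem_singleton] at hlj
      have hcoef := (Finset.mem_filter.1 hj).2
      obtain ⟨ε, rfl⟩ : ∃ ε, j = Fintype.equivFin _ ε := ⟨(Fintype.equivFin _).symm j, by simp⟩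
      rw [gridSystem_coeff] at hcoef
      rw [hlj]
      show gi k ε ∈ _
      by_cases h1 : (gridEnds ε).1 = w
      · exact gi_mem_cellVars_of_left (by rw [leftEdges, Finset.mem_filter]; exact ⟨Finset.mem_univ _, h1⟩)
      · by_cases h2 : (gridEnds ε).2 = w
        · exact gi_mem_cellVars_of_right (by rw [rightEdges, Finset.mem_filter]; exact ⟨Finset.mem_univ _, h2⟩)
        · exfalso; apply hcoef; rw [if_neg h1, if_neg h2, add_zero]
    · intro τ hτ
      apply B.substClause_eval hE α hc τ
      apply B.rowSum_zval_right hE α τ w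
      have hcnf : (equationCNF 1 (gridSystem k (B.charge hE α) (Fintype.equivFin _ w))).eval τ = true :=
        (CNF.eval_eq_true_iff _ _).2 fun C hC => by rw [← eval_clauseOf]; exact hτ C hC
      rw [eval_equationCNF] at hcnf
      exact (gridSystem_holds_iff k _ w τ).1 (of_decide_eq_true hcnf)
  push Not at hR
  by_cases hL : ∃ u, r = B.f (u, false)
  · -- a left branch vertex: a tautology over the variables entering the left copy of `u`
    obtain ⟨u, rfl⟩ := hL
    refine tautCase ((leftEdges u).toList.map (gi k)) (((leftEdges u).nodup_toList).map (gi_injective k))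
      (by rw [List.length_map, Finset.length_toList]; exact (card_leftEdges_le u).trans (by norm_num)) ?_
      fun τ => B.rowSum_zval_left hE α τ u
    intro x hx
    obtain ⟨e, t, ht, hr, hxe⟩ := B.mem_vars_substClause hE α hc hx
    have hsup : B.f (u, false) ∈ (B.P e).support := by
      rcases hr with hr | hr <;> rw [hr] <;> exact B.row_mem_support e _
    have hend : lend e = u := by
      rcases B.branch e _ hsup with h | h
      · simp only [Prod.mk.injEq, and_true] at h; exact h.symm
      · simp at h
    obtain ⟨ε, rfl, hε⟩ := B.mem_vars_baseForm hE α hxe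
    rcases hε with rfl | ⟨u', rfl, hε⟩
    · exact List.mem_map.2 ⟨ε, Finset.mem_toList.2 (by
        rw [leftEdges, Finset.mem_filter]; exact ⟨Finset.mem_univ _, hend⟩), rfl⟩
    · have hu : u' = u := hend
      subst hu
      exact List.mem_map.2 ⟨ε, Finset.mem_toList.2 hε, rfl⟩
  push Not at hL
  by_cases hI : ∃ e t, 0 < t ∧ t < B.len e ∧ r = B.row e t
  · -- a suppressed (internal) row of the path of `e₀`: a tautology over the variables of `baseForm e₀`
    obtain ⟨e₀, t₀, h0, h1, rfl⟩ := hI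
    have key : ∀ x ∈ ((KrajicekRamsey.clauseOf c).subst (B.subst hE α)).vars, x ∈ (B.baseForm hE α e₀).vars := by
      intro x hx
      obtain ⟨e, t, ht, hr, hxe⟩ := B.mem_vars_substClause hE α hc hx
      have hsup : B.row e₀ t₀ ∈ (B.P e).support := by
        rcases hr with hr | hr <;> rw [hr] <;> exact B.row_mem_support e _
      have hee : e = e₀ := by
        by_contra hne
        exact B.row_not_mem_support (Ne.symm hne) h0 h1 hsup
      subst hee
      exact hxe
    rcases e₀ with w | ε
    · refine tautCase ((leftEdges w).toList.map (gi k)) (((leftEdges w).nodup_toList).map (gi_injective k))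
        (by rw [List.length_map, Finset.length_toList]; exact (card_leftEdges_le w).trans (by norm_num))
        (fun x hx => mem_vars_xorForm (key x hx)) fun τ => B.rowSum_zval_internal hE α τ h0 h1
    · refine tautCase [gi k ε] (List.nodup_singleton _) (by simp) (fun x hx => ?_)
        fun τ => B.rowSum_zval_internal hE α τ h0 h1
      have := key x hx
      simp only [BrickEmbedding.baseForm, PropForm.vars, Finset.mem_singleton] at this
      simp [this]
  · -- a row off the subdivision: no variables, satisfied by `α`
    push Not at hI
    have hoff' : ∀ e, r ∉ (B.P e).support := by
      intro e hsup
      obtain ⟨t, htl, hrt⟩ := B.exists_row_of_mem_support hsup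
      rcases Nat.eq_zero_or_pos t with rfl | ht0
      · exact hL (lend e) (by rw [← hrt, B.row_zero])
      · rcases lt_or_eq_of_le htl with htl | rfl
        · exact hI e t ht0 htl hrt.symm
        · exact hR (rend e) (by rw [← hrt, B.row_len])
    refine tautCase [] List.nodup_nil (by simp) (fun x hx => ?_) fun τ => B.rowSum_zval_off hE α τ hoff' (hα r hoff')
    obtain ⟨e, t, ht, hr, -⟩ := B.mem_vars_substClause hE α hc hx
    exfalso
    rcases hr with hr | hr <;> exact hoff' e (hr ▸ B.row_mem_support e _)

end BrickEmbedding

/-! ### The grid refutation -/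

/-- Bookkeeping: the size bound of the transfer lemma for `qq = 16` clauses and `k = 4`
variables is cubic. [folklore] -/
theorem transfer_bound_arith (S Z : ℕ) (hS : S ≤ Z) :
    transferLines S Z 16 4 * (40 * ((16 + 3) * (Z + 3) + 4) + 300) ≤ 2 ^ 54 * (Z + 3) ^ 3 := by
  have h1 : transferClauseLines Z 16 4 + 51 ≤ 2 ^ 42 * (Z + 3) := by
    unfold transferClauseLines tautLines
    norm_num
    omega
  have h2 : transferLines S Z 16 4 ≤ 2 ^ 43 * (Z + 3) ^ 2 := by
    unfold transferLines
    have := Nat.mul_le_mul_left Z h1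
    nlinarith
  have h3 : 40 * ((16 + 3) * (Z + 3) + 4) + 300 ≤ 2 ^ 11 * (Z + 3) := by omega
  calc _ ≤ 2 ^ 43 * (Z + 3) ^ 2 * (2 ^ 11 * (Z + 3)) := Nat.mul_le_mul h2 h3
    _ = 2 ^ 54 * (Z + 3) ^ 3 := by ring

/-- **From `T(G, f)` to a grid Tseitin formula** (GIRS §3, proof of Thm. 18 up to the application
of Håstad's theorem). If the row graph `G` of the graph Tseitin system `E` is connected and contains
a subdivision of the brick graph `bricks k`, then from a depth-`d` `textbookFrege` proof `π` of
`¬ T(G, f) = ¬ ofCNF (sumEncoding 1 E)` one obtains, for suitable charges `f'`, a depth-`(d + 23)`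
proof of the negated Tseitin formula `¬ ofCNF (sumEncoding 1 (gridSystem k f'))` of the grid
`𝓗_{k,k}` of size at most `2^78 (proofSize π + (k+1)^2 + 1)^3` ("of size `poly(|T(G,f)|) + O(S)`
and depth `d + O(1)`"). [cite: GalesiEtAl2023, Lemmas 11–16 and proof of Theorem 18] -/
theorem exists_gridRefutation {n m k : ℕ} {E : Fin m → LinEqMod 2 n} {G : SimpleGraph (Fin m)}
    (hE : IsGraphSystem E G) (hconn : G.Connected) (B : BrickEmbedding k G)
    {d : ℕ} {π : List (PropForm ℕ)}
    (hπ : textbookFrege.IsDepthProofOf d π (neg (PropForm.ofCNF (sumEncoding 1 E)))) :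
    ∃ (f : Fin (k + 1) × Fin (k + 1) → ZMod 2) (π' : List (PropForm ℕ)),
      textbookFrege.IsDepthProofOf (d + 23) π' (neg (PropForm.ofCNF (sumEncoding 1 (gridSystem k f)))) ∧
      proofSize π' ≤ 2 ^ 78 * (proofSize π + (k + 1) ^ 2 + 1) ^ 3 := by
  classical
  -- Lemma 11: an assignment satisfying every row off the subdivision
  set Sset : Finset (Fin m) := univ.filter fun r => ∃ e, r ∈ (B.P e).support with hSset
  have hS : Sset.Nonempty := by
    refine ⟨B.f (((0 : Fin (k + 1)), (0 : Fin (k + 1))), false), ?_⟩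
    simp only [hSset, Finset.mem_filter, Finset.mem_univ, true_and]
    exact ⟨Sum.inl (0, 0), (B.P _).start_mem_support⟩
  obtain ⟨α, hα⟩ := exists_offAssignment hE hconn Sset hS
  have hα' : ∀ r, (∀ e, r ∉ (B.P e).support) → rowVal E α r = (E r).2 := fun r hr =>
    hα r (by simp [hSset, hr])
  -- Lemma 10: transfer along the substitution
  obtain ⟨π', hπ', hsize⟩ := transfer_isDepthProofOf (sumEncoding 1 E)
    (sumEncoding 1 (gridSystem k (B.charge hE α))) (B.subst hE α) (Zσ := 29) (Tσ := 7) (qq := 16)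
    (k := 4) (B.size_subst_le hE α) (by norm_num) (B.altDepthAux_subst_le_seven hE α) hπ
    (fun c hc => B.transfer_hloc hE α hα' hc)
  refine ⟨B.charge hE α, π', by rw [show d + 23 = d + 7 + 16 by omega]; exact hπ', hsize.trans ?_⟩
  -- bookkeeping
  set S := proofSize π
  set N' := msum ((sumEncoding 1 (gridSystem k (B.charge hE α))).map KrajicekRamsey.clauseOf)
  have hN' : N' ≤ 224 * (k + 1) ^ 2 := msum_gridEncoding_le k _
  calc _ ≤ 2 ^ 54 * (S * 29 + N' + 3) ^ 3 := transfer_bound_arith S (S * 29 + N') (by omega)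
    _ ≤ 2 ^ 54 * (224 * (S + (k + 1) ^ 2 + 1)) ^ 3 := by
        refine Nat.mul_le_mul_left _ (Nat.pow_le_pow_left ?_ 3)
        generalize (k + 1) ^ 2 = M at *
        omega
    _ ≤ 2 ^ 78 * (S + (k + 1) ^ 2 + 1) ^ 3 := by
        rw [mul_pow, ← mul_assoc]
        exact Nat.mul_le_mul_right _ (by norm_num)

/-! ### Elementary real analysis of GIRS §3.3 (explicit thresholds) -/

namespace TseitinNumerics

/-- The depth side condition of Håstad's theorem holds for large grids: if
`x ≥ max 16 (exp ((2D/K)^2))` then `D ≤ K log x / log log x`. [folklore] -/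
theorem depth_condition {K D x : ℝ} (hK : 0 < K) (hD : 0 < D) (hx16 : 16 ≤ x)
    (hx : Real.exp ((2 * D / K) ^ 2) ≤ x) : D ≤ K * Real.log x / Real.log (Real.log x) := by
  have hlog16 : 1 < Real.log 16 := by
    rw [← Real.exp_lt_exp, Real.exp_log (by norm_num)]
    have := Real.exp_one_lt_d9; linarith
  have hL1 : 1 < Real.log x := hlog16.trans_le (Real.log_le_log (by norm_num) hx16)
  have hL0 : 0 < Real.log x := by linarith
  have hLL : 0 < Real.log (Real.log x) := Real.log_pos hL1
  rw [le_div_iff₀ hLL]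
  have h1 : Real.log (Real.log x) ≤ (Real.log x) ^ (1 / 2 : ℝ) / (1 / 2) :=
    Real.log_le_rpow_div hL0.le (by norm_num)
  have h2 : 2 * D / K ≤ (Real.log x) ^ (1 / 2 : ℝ) := by
    have hsq : (2 * D / K) ^ 2 ≤ Real.log x := by
      rw [← Real.log_exp ((2 * D / K) ^ 2)]; exact Real.log_le_log (Real.exp_pos _) hx
    have h0 : 0 ≤ 2 * D / K := by positivity
    calc 2 * D / K = ((2 * D / K) ^ 2) ^ (1 / 2 : ℝ) := by
          rw [← Real.sqrt_eq_rpow, Real.sqrt_sq h0]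
      _ ≤ (Real.log x) ^ (1 / 2 : ℝ) := Real.rpow_le_rpow (by positivity) hsq (by norm_num)
  set s := (Real.log x) ^ (1 / 2 : ℝ) with hs
  have hs0 : 0 ≤ s := Real.rpow_nonneg hL0.le _
  have hLs : Real.log x = s * s := by
    rw [hs, ← Real.rpow_add hL0]; norm_num
  have h3 : 2 * D ≤ K * s := by
    rw [div_le_iff₀ hK] at h2; linarith
  calc D * Real.log (Real.log x) ≤ D * (s / (1 / 2)) := mul_le_mul_of_nonneg_left h1 hD.le
    _ = 2 * D * s := by ring
    _ ≤ (K * s) * s := mul_le_mul_of_nonneg_right h3 hs0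
    _ = K * Real.log x := by rw [hLs]; ring

/-- Polynomial versus `2^{x^ε}`: if `x ≥ 3` and `x ≥ (max 13 (36/(ε log 2)))^{2/ε}` then
`(x+1)^2 + 1 ≤ 2^{x^ε/3 - 27}`. [folklore] -/
theorem poly_condition {ε x : ℝ} (hε : 0 < ε) (hx3 : 3 ≤ x)
    (hx : (max 13 (36 / (ε * Real.log 2))) ^ (2 / ε) ≤ x) :
    (x + 1) ^ 2 + 1 ≤ (2 : ℝ) ^ (x ^ ε / 3 - 27) := by
  have hx0 : 0 < x := by linarith
  have hl2 : 0 < Real.log 2 := Real.log_pos (by norm_num)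
  set M := max 13 (36 / (ε * Real.log 2)) with hM
  have hM0 : 0 ≤ M := le_max_of_le_left (by norm_num)
  set u := x ^ (ε / 2) with hu
  have hu0 : 0 < u := Real.rpow_pos_of_pos hx0 _
  have huM : M ≤ u := by
    calc M = (M ^ (2 / ε)) ^ (ε / 2) := by
          rw [← Real.rpow_mul hM0, show 2 / ε * (ε / 2) = 1 by field_simp, Real.rpow_one]
      _ ≤ x ^ (ε / 2) := Real.rpow_le_rpow (Real.rpow_nonneg hM0 _) hx (by positivity)
  have hu13 : 13 ≤ u := (le_max_left _ _).trans huM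
  have hu36 : 36 / (ε * Real.log 2) ≤ u := (le_max_right _ _).trans huM
  have hu36' : 36 ≤ u * (ε * Real.log 2) := by rwa [div_le_iff₀ (by positivity)] at hu36
  have hxe : x ^ ε = u * u := by rw [hu, ← Real.rpow_add hx0]; ring_nf
  have hlog : Real.log x ≤ u / (ε / 2) := Real.log_le_rpow_div hx0.le (by positivity)
  rw [div_div_eq_mul_div] at hlog
  have h1 : 3 * Real.log x ≤ 6 * u / ε := by
    calc 3 * Real.log x ≤ 3 * (u * 2 / ε) := by linarith
      _ = 6 * u / ε := by ring
  have h2 : 6 * u / ε ≤ (u * u / 3 - 27) * Real.log 2 := by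
    rw [div_le_iff₀ hε]
    have ha : 6 * u ≤ u * u / 6 * Real.log 2 * ε := by
      have := mul_le_mul_of_nonneg_left hu36' (by positivity : (0 : ℝ) ≤ u / 6)
      nlinarith
    have hb : 0 ≤ (u * u / 6 - 27) * Real.log 2 * ε := by
      have : (0 : ℝ) ≤ u * u / 6 - 27 := by nlinarith
      positivity
    nlinarith
  have key : 3 * Real.log x ≤ (x ^ ε / 3 - 27) * Real.log 2 := by rw [hxe]; linarith
  have hpoly : (x + 1) ^ 2 + 1 ≤ x ^ 3 := by nlinarith
  have e1 : x ^ 3 = Real.exp (3 * Real.log x) := by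
    rw [show (3 : ℝ) * Real.log x = ((3 : ℕ) : ℝ) * Real.log x by norm_num, Real.exp_nat_mul,
      Real.exp_log hx0]
  calc (x + 1) ^ 2 + 1 ≤ x ^ 3 := hpoly
    _ ≤ (2 : ℝ) ^ (x ^ ε / 3 - 27) := by
        rw [e1, Real.rpow_def_of_pos (by norm_num : (0 : ℝ) < 2)]
        exact Real.exp_le_exp.2 (by linarith)

/-- The exponent comparison: if `t ≥ 1`, `γ ≤ e/20` and `t ≥ (max 27 (6/κ))^{20/e}` then
`t^γ ≤ κ t^{e/10}/3 - 27`. [folklore] -/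
theorem exponent_condition {κ e γ t : ℝ} (hκ : 0 < κ) (he : 0 < e) (ht1 : 1 ≤ t) (hγ : γ ≤ e / 20)
    (ht : (max 27 (6 / κ)) ^ (20 / e) ≤ t) : t ^ γ ≤ κ * t ^ (e / 10) / 3 - 27 := by
  have ht0 : 0 < t := by linarith
  set M := max 27 (6 / κ) with hM
  have hM0 : 0 ≤ M := le_max_of_le_left (by norm_num)
  set v := t ^ (e / 20) with hv
  have hv0 : 0 < v := Real.rpow_pos_of_pos ht0 _
  have hvM : M ≤ v := by
    calc M = (M ^ (20 / e)) ^ (e / 20) := by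
          rw [← Real.rpow_mul hM0, show 20 / e * (e / 20) = 1 by field_simp, Real.rpow_one]
      _ ≤ t ^ (e / 20) := Real.rpow_le_rpow (Real.rpow_nonneg hM0 _) ht (by positivity)
  have hv27 : 27 ≤ v := (le_max_left _ _).trans hvM
  have hv6 : 6 / κ ≤ v := (le_max_right _ _).trans hvM
  have hv6' : 6 ≤ v * κ := by rwa [div_le_iff₀ hκ] at hv6
  have hte : t ^ (e / 10) = v * v := by rw [hv, ← Real.rpow_add ht0]; ring_nf
  have hγ' : t ^ γ ≤ v := Real.rpow_le_rpow_of_exponent_le ht1 hγ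
  rw [hte]
  have := mul_le_mul_of_nonneg_left hv6' hv0.le
  nlinarith

/-- The size chain: from `2^A ≤ 2^78 · (S + P)^3`, `P ≤ 2^{A/3 - 27}` and `B ≤ A/3 - 27`
conclude `2^B ≤ S`. [folklore] -/
theorem size_condition {A B S P : ℝ} (hS0 : 0 ≤ S) (hP0 : 0 ≤ P)
    (hP : (2 : ℝ) ^ A ≤ 2 ^ (78 : ℕ) * (S + P) ^ 3)
    (hPle : P ≤ (2 : ℝ) ^ (A / 3 - 27)) (hB : B ≤ A / 3 - 27) : (2 : ℝ) ^ B ≤ S := by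
  have h2 : (0 : ℝ) < 2 := by norm_num
  set W := (2 : ℝ) ^ (A / 3 - 26) with hW
  have hW3 : W ^ 3 = (2 : ℝ) ^ (A - 78) := by
    rw [hW, ← Real.rpow_natCast, ← Real.rpow_mul h2.le]; norm_num; ring_nf
  have h78 : (2 : ℝ) ^ (78 : ℕ) * (2 : ℝ) ^ (A - 78) = (2 : ℝ) ^ A := by
    rw [← Real.rpow_natCast, ← Real.rpow_add h2]; norm_num
  have hXW : W ≤ S + P := by
    by_contra hlt
    push Not at hlt
    have h0 : 0 ≤ S + P := by positivity
    have : (S + P) ^ 3 < W ^ 3 := pow_lt_pow_left₀ hlt h0 (by norm_num)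
    rw [hW3] at this
    have := mul_lt_mul_of_pos_left this (by positivity : (0 : ℝ) < 2 ^ (78 : ℕ))
    rw [h78] at this
    linarith
  have hWZ : W = 2 * (2 : ℝ) ^ (A / 3 - 27) := by
    rw [hW, show A / 3 - 26 = A / 3 - 27 + 1 by ring, Real.rpow_add h2, Real.rpow_one]; ring
  calc (2 : ℝ) ^ B ≤ (2 : ℝ) ^ (A / 3 - 27) := Real.rpow_le_rpow_of_exponent_le (by norm_num) hB
    _ = W - (2 : ℝ) ^ (A / 3 - 27) := by rw [hWZ]; ring
    _ ≤ S := by linarith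

/-- From `t ≥ (Q/b)^10` to `b t^{1/10} ≥ Q`. [folklore] -/
theorem tenth_root_condition {Q b t : ℝ} (hb : 0 < b) (hQ : 0 ≤ Q) (ht : (Q / b) ^ (10 : ℝ) ≤ t) :
    Q ≤ b * t ^ (1 / 10 : ℝ) := by
  have h0 : 0 ≤ Q / b := by positivity
  have : Q / b ≤ t ^ (1 / 10 : ℝ) := by
    calc Q / b = ((Q / b) ^ (10 : ℝ)) ^ (1 / 10 : ℝ) := by
          rw [← Real.rpow_mul h0]; norm_num
      _ ≤ t ^ (1 / 10 : ℝ) := Real.rpow_le_rpow (Real.rpow_nonneg h0 _) ht (by norm_num)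
  rwa [div_le_iff₀' hb] at this

end TseitinNumerics

/-! ### The conditional theorem -/

/-- **GIRS Theorem 18, conditionally on Håstad's grid theorem (H) and the wall form of the
polynomial excluded-grid theorem (W).** Assume
(H) `∃ K > 0, ∃ c > 0, ∃ n₀, ∀ n ≥ n₀, ∀ d ≤ K log n / log log n`, every depth-`d` `textbookFrege`
proof of `¬ T` for a Tseitin system `T` of the grid `𝓗_{n,n}` (any charges) has size
`≥ 2^{n^{c/d}}` [GIRS Thm. 17 = Håstad, JACM 2021, Thm. 6.5], and
(W) `∃ c > 0, ∃ t₁, ∀` finite `G` with `tw(G) ≥ t₁`, `∃ r ≥ c · tw(G)^{1/10}` with `W_r ≼ₜ G`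
[GIRS Cor. 9, from Chuzhoy–Tan Thm. 1.1].
Then `galesiEtAl_tseitin_treewidth_depthFrege_lowerBound` holds: with `c := c_H / 480`, for
every `d` there is `t₀(d)` such that every depth-`d` `textbookFrege` refutation of the Tseitin
formula of a connected (multi)graph of treewidth `≥ t₀(d)` has size `≥ 2^{tw^{c/d}}`.
Proof: §3.3 of the source with the reduction `exists_gridRefutation` (grid `𝓗_{k,k}`,
`k = ⌊(r-3)/3⌋`, depth `d + 23`, size `≤ 2^78 (S + (k+1)^2 + 1)^3`) and explicit thresholds
(`TseitinNumerics`). [cite: GalesiEtAl2023, Theorem 18 (proof, §3.3)] -/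
theorem galesiEtAl_tseitin_treewidth_depthFrege_lowerBound_of_hastad_of_wall
    (hgrid : ∃ K : ℝ, 0 < K ∧ ∃ c : ℝ, 0 < c ∧ ∃ n₀ : ℕ, ∀ n : ℕ, n₀ ≤ n → ∀ d : ℕ,
      (d : ℝ) ≤ K * Real.log n / Real.log (Real.log n) →
      ∀ (m v : ℕ) (E : Fin m → LinEqMod 2 v), IsGridTseitinSystem n E →
      ∀ π : List (PropForm ℕ),
        textbookFrege.IsDepthProofOf d π (neg (PropForm.ofCNF (sumEncoding 1 E))) →
        (2 : ℝ) ^ ((n : ℝ) ^ (c / d)) ≤ (proofSize π : ℝ))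
    (hwall : ∃ c : ℝ, 0 < c ∧ ∃ t₁ : ℕ, ∀ (V : Type) [Fintype V] (G : SimpleGraph V),
      t₁ ≤ treewidth G → ∃ r : ℕ, c * (treewidth G : ℝ) ^ (1 / 10 : ℝ) ≤ r ∧ wall r ≼ₜ G) :
    galesiEtAl_tseitin_treewidth_depthFrege_lowerBound := by
  obtain ⟨K, hK, c₁, hc₁, n₀, hgrid⟩ := hgrid
  obtain ⟨c₂, hc₂, t₁, hwall⟩ := hwall
  refine ⟨c₁ / 480, by positivity, fun d => ?_⟩
  -- depth 0: there is no depth-0 proof of a negation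
  rcases Nat.eq_zero_or_pos d with rfl | hdpos
  · refine ⟨0, ?_⟩
    intro n m E G _ _ _ _ π hπ
    exfalso
    have h := hπ.2 _ (List.mem_of_getLast? hπ.1.2)
    simp [PropForm.altDepth, PropForm.altDepthAux] at h
  -- constants and thresholds for the depth `d ≥ 1`
  set D : ℝ := (d : ℝ) + 23 with hD
  set ε : ℝ := c₁ / D with hε
  have hD0 : 0 < D := by positivity
  have hε0 : 0 < ε := by positivity
  set b : ℝ := min 1 (c₂ / 6) with hb
  have hb0 : 0 < b := lt_min one_pos (by positivity)
  have hb1 : b ≤ 1 := min_le_left _ _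
  have hb6 : 6 * b ≤ c₂ := by have := min_le_right 1 (c₂ / 6); linarith
  set κ : ℝ := b ^ (c₁ / 23) with hκ
  have hκ0 : 0 < κ := Real.rpow_pos_of_pos hb0 _
  set Q : ℝ := max (max (n₀ : ℝ) 16)
    (max (Real.exp ((2 * D / K) ^ 2)) ((max 13 (36 / (ε * Real.log 2))) ^ (2 / ε))) with hQ
  have hQ16 : 16 ≤ Q := (le_max_right _ _).trans (le_max_left _ _)
  have hQ0 : 0 ≤ Q := by linarith
  set T : ℝ := max (max (t₁ : ℝ) 1) (max ((Q / b) ^ (10 : ℝ)) ((max 27 (6 / κ)) ^ (20 / ε))) with hT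
  refine ⟨⌈T⌉₊, ?_⟩
  intro n m E G hcol hadj hconn htw π hπ
  -- unpack the threshold
  have hT' : T ≤ (treewidth G : ℝ) := Nat.ceil_le.1 htw
  have ht₁ : t₁ ≤ treewidth G := by
    have : (t₁ : ℝ) ≤ treewidth G := ((le_max_left _ _).trans (le_max_left _ _)).trans hT'
    exact_mod_cast this
  have htw1 : (1 : ℝ) ≤ treewidth G := ((le_max_right _ _).trans (le_max_left _ _)).trans hT'
  have hTQ : (Q / b) ^ (10 : ℝ) ≤ treewidth G :=
    ((le_max_left _ _).trans (le_max_right _ _)).trans hT'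
  have hTM : (max 27 (6 / κ)) ^ (20 / ε) ≤ treewidth G :=
    ((le_max_right _ _).trans (le_max_right _ _)).trans hT'
  -- (W): a wall, hence a brick graph, as a topological minor
  obtain ⟨r, hr, hwallG⟩ := hwall (Fin m) G ht₁
  have htw10 : 0 ≤ (treewidth G : ℝ) ^ (1 / 10 : ℝ) := Real.rpow_nonneg (by positivity) _
  have hbQ : Q ≤ b * (treewidth G : ℝ) ^ (1 / 10 : ℝ) :=
    TseitinNumerics.tenth_root_condition hb0 hQ0 hTQ
  have hbr : 6 * (b * (treewidth G : ℝ) ^ (1 / 10 : ℝ)) ≤ r :=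
    calc 6 * (b * (treewidth G : ℝ) ^ (1 / 10 : ℝ)) = (6 * b) * (treewidth G : ℝ) ^ (1 / 10 : ℝ) := by
          ring
      _ ≤ c₂ * (treewidth G : ℝ) ^ (1 / 10 : ℝ) := mul_le_mul_of_nonneg_right hb6 htw10
      _ ≤ r := hr
  have hr96 : 96 ≤ r := by
    have : (96 : ℝ) ≤ r := by linarith
    exact_mod_cast this
  set k : ℕ := (r - 3) / 3 with hk
  have hk3 : 3 * k + 3 ≤ r := by omega
  have hkr : r ≤ 6 * k := by omega
  have hkr' : (r : ℝ) ≤ 6 * k := by exact_mod_cast hkr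
  have hbk : b * (treewidth G : ℝ) ^ (1 / 10 : ℝ) ≤ k := by linarith
  have hkQ : Q ≤ k := hbQ.trans hbk
  obtain ⟨B⟩ := BrickEmbedding.nonempty_of_isTopologicalMinor
    (bricks_isTopologicalMinor (wall_isTopologicalMinor_of_le hk3 hwallG))
  -- the reduction (§3.1–3.2): a refutation of the grid Tseitin formula
  obtain ⟨f, π', hπ', hsize⟩ := exists_gridRefutation ⟨hcol, hadj⟩ hconn B hπ
  -- (H) applies to it
  have hkn₀ : n₀ ≤ k := by
    have : (n₀ : ℝ) ≤ k := ((le_max_left _ _).trans (le_max_left _ _)).trans hkQ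
    exact_mod_cast this
  have hk16 : (16 : ℝ) ≤ k := hQ16.trans hkQ
  have hkexp : Real.exp ((2 * D / K) ^ 2) ≤ k := ((le_max_left _ _).trans (le_max_right _ _)).trans hkQ
  have hkM : (max 13 (36 / (ε * Real.log 2))) ^ (2 / ε) ≤ k :=
    ((le_max_right _ _).trans (le_max_right _ _)).trans hkQ
  have hdepth : ((d + 23 : ℕ) : ℝ) ≤ K * Real.log k / Real.log (Real.log k) := by
    have := TseitinNumerics.depth_condition hK hD0 hk16 hkexp
    push_cast
    exact this
  have hlow := hgrid k hkn₀ (d + 23) hdepth _ _ (gridSystem k f) (isGridTseitinSystem_gridSystem k f)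
    π' hπ'
  have hA : (2 : ℝ) ^ ((k : ℝ) ^ ε) ≤ 2 ^ (78 : ℕ) * ((proofSize π : ℝ) + (((k : ℝ) + 1) ^ 2 + 1)) ^ 3 := by
    have h1 : (proofSize π' : ℝ) ≤ 2 ^ (78 : ℕ) * ((proofSize π : ℝ) + ((k : ℝ) + 1) ^ 2 + 1) ^ 3 := by
      exact_mod_cast hsize
    have h2 : (2 : ℝ) ^ ((k : ℝ) ^ ε) ≤ proofSize π' := by
      have := hlow
      push_cast at this
      exact this
    rw [← add_assoc]
    exact h2.trans h1
  -- the polynomial term is negligible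
  have hP : ((k : ℝ) + 1) ^ 2 + 1 ≤ (2 : ℝ) ^ ((k : ℝ) ^ ε / 3 - 27) :=
    TseitinNumerics.poly_condition hε0 (by linarith) hkM
  -- the exponent comparison `tw^{c/d} ≤ k^ε/3 - 27`
  have hεle : ε ≤ c₁ / 23 := by
    rw [hε]
    exact div_le_div_of_nonneg_left hc₁.le (by norm_num)
      (by rw [hD]; linarith [(Nat.cast_nonneg d : (0 : ℝ) ≤ d)])
  have hκε : κ ≤ b ^ ε := Real.rpow_le_rpow_of_exponent_ge hb0 hb1 hεle
  have hkε : κ * (treewidth G : ℝ) ^ (ε / 10) ≤ (k : ℝ) ^ ε := by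
    have e1 : (treewidth G : ℝ) ^ (ε / 10) = ((treewidth G : ℝ) ^ (1 / 10 : ℝ)) ^ ε := by
      rw [← Real.rpow_mul (by positivity)]; ring_nf
    calc κ * (treewidth G : ℝ) ^ (ε / 10) ≤ b ^ ε * ((treewidth G : ℝ) ^ (1 / 10 : ℝ)) ^ ε := by
          rw [e1]; exact mul_le_mul_of_nonneg_right hκε (Real.rpow_nonneg htw10 _)
      _ = (b * (treewidth G : ℝ) ^ (1 / 10 : ℝ)) ^ ε := by rw [Real.mul_rpow hb0.le htw10]
      _ ≤ (k : ℝ) ^ ε := Real.rpow_le_rpow (by positivity) hbk hε0.le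
  have hγ : c₁ / 480 / (d : ℝ) ≤ ε / 20 := by
    have hd1 : (1 : ℝ) ≤ d := by exact_mod_cast hdpos
    rw [div_div, hε, div_div]
    exact div_le_div_of_nonneg_left hc₁.le (by positivity) (by rw [hD]; linarith)
  have hB : (treewidth G : ℝ) ^ (c₁ / 480 / (d : ℝ)) ≤ (k : ℝ) ^ ε / 3 - 27 :=
    (TseitinNumerics.exponent_condition hκ0 hε0 htw1 hγ hTM).trans (by linarith)
  -- conclude (§3.3)
  exact TseitinNumerics.size_condition (Nat.cast_nonneg _) (by positivity) hA hP hB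

/-! ### The conditional theorem on the weakest usable forms of the two inputs -/

namespace TseitinNumerics

/-- From `t ≥ (Q/b)^{1/δ}` to `b t^δ ≥ Q`. [folklore] -/
theorem root_condition {Q b t δ : ℝ} (hb : 0 < b) (hδ : 0 < δ) (hQ : 0 ≤ Q)
    (ht : (Q / b) ^ (1 / δ) ≤ t) : Q ≤ b * t ^ δ := by
  have h0 : 0 ≤ Q / b := by positivity
  have : Q / b ≤ t ^ δ := by
    calc Q / b = ((Q / b) ^ (1 / δ)) ^ δ := by
          rw [← Real.rpow_mul h0, one_div_mul_cancel hδ.ne', Real.rpow_one]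
      _ ≤ t ^ δ := Real.rpow_le_rpow (Real.rpow_nonneg h0 _) ht hδ.le
  rwa [div_le_iff₀' hb] at this

/-- The exponent comparison for a general root: if `t ≥ 1`, `γ ≤ eδ/2` and
`t ≥ (max 27 (6/κ))^{2/(eδ)}` then `t^γ ≤ κ t^{eδ}/3 - 27` (the case `δ = 1/10` is
`exponent_condition`, to which this reduces with `t' = t^{10δ}`). [folklore] -/
theorem exponent_condition' {κ e δ γ t : ℝ} (hκ : 0 < κ) (he : 0 < e) (hδ : 0 < δ) (ht1 : 1 ≤ t)
    (hγ : γ ≤ e * δ / 2) (ht : (max 27 (6 / κ)) ^ (2 / (e * δ)) ≤ t) :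
    t ^ γ ≤ κ * t ^ (e * δ) / 3 - 27 := by
  have ht0 : 0 < t := by linarith
  set t' := t ^ (10 * δ) with ht'
  have ht'1 : 1 ≤ t' := Real.one_le_rpow ht1 (by positivity)
  have h1 : t' ^ (e / 10) = t ^ (e * δ) := by
    rw [ht', ← Real.rpow_mul ht0.le]; ring_nf
  have h2 : t' ^ (γ / (10 * δ)) = t ^ γ := by
    rw [ht', ← Real.rpow_mul ht0.le]
    congr 1
    field_simp
  have hγ' : γ / (10 * δ) ≤ e / 20 := by
    rw [div_le_iff₀ (by positivity)]; linarith
  have hM0 : 0 ≤ max 27 (6 / κ) := le_max_of_le_left (by norm_num)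
  have ht'M : (max 27 (6 / κ)) ^ (20 / e) ≤ t' := by
    calc (max 27 (6 / κ)) ^ (20 / e) = ((max 27 (6 / κ)) ^ (2 / (e * δ))) ^ (10 * δ) := by
          rw [← Real.rpow_mul hM0]
          congr 1
          field_simp
          ring
      _ ≤ t ^ (10 * δ) := Real.rpow_le_rpow (Real.rpow_nonneg hM0 _) ht (by positivity)
  have := exponent_condition hκ he ht'1 hγ' ht'M
  rwa [h2, h1] at this

end TseitinNumerics

/-- **GIRS Theorem 18 reduced to its two inputs in their weakest usable form.** Assume
(H′) the grid case of the bound, depth by depth: `∃ c > 0, ∀ d, ∃ n₁, ∀ n ≥ n₁`, every depth-`d`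
`textbookFrege` proof of `¬ T` for a Tseitin system `T` of the grid `𝓗_{n,n}` (any charges) has
size `≥ 2^{n^{c/d}}` — a consequence of Håstad's grid theorem in the form (H) of
`galesiEtAl_tseitin_treewidth_depthFrege_lowerBound_of_hastad_of_wall` (GIRS Thm. 17), see
`gridBound_of_hastadForm`; and
(W_δ) a polynomial excluded-grid theorem in wall form with ANY exponent: `∃ δ > 0, ∃ c > 0, ∃ t₁,
∀` finite `G` with `tw(G) ≥ t₁`, `∃ r ≥ c · tw(G)^δ` with `W_r ≼ₜ G` (GIRS Cor. 9 gives `δ = 1/10`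
from Chuzhoy–Tan; Chekuri–Chuzhoy's `δ = 1/98` would do as well).
Then `galesiEtAl_tseitin_treewidth_depthFrege_lowerBound` holds, with `c := c_{H′} δ / 48`.
Proof: §3.3 of the source with the reduction `exists_gridRefutation` (grid `𝓗_{k,k}`,
`k = ⌊(r-3)/3⌋`, depth `d + 23`, size `≤ 2^78 (S + (k+1)^2 + 1)^3`) and explicit thresholds
(`TseitinNumerics`). [cite: GalesiEtAl2023, Theorem 18 (proof, §3.3)] -/
theorem galesiEtAl_tseitin_treewidth_depthFrege_lowerBound_of_grid_of_wall
    (hgrid : ∃ c : ℝ, 0 < c ∧ ∀ d : ℕ, ∃ n₁ : ℕ, ∀ n : ℕ, n₁ ≤ n →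
      ∀ (m v : ℕ) (E : Fin m → LinEqMod 2 v), IsGridTseitinSystem n E →
      ∀ π : List (PropForm ℕ),
        textbookFrege.IsDepthProofOf d π (neg (PropForm.ofCNF (sumEncoding 1 E))) →
        (2 : ℝ) ^ ((n : ℝ) ^ (c / d)) ≤ (proofSize π : ℝ))
    (hwall : ∃ δ : ℝ, 0 < δ ∧ ∃ c : ℝ, 0 < c ∧ ∃ t₁ : ℕ, ∀ (V : Type) [Fintype V]
      (G : SimpleGraph V), t₁ ≤ treewidth G →
      ∃ r : ℕ, c * (treewidth G : ℝ) ^ δ ≤ r ∧ wall r ≼ₜ G) :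
    galesiEtAl_tseitin_treewidth_depthFrege_lowerBound := by
  obtain ⟨c₁, hc₁, hgrid⟩ := hgrid
  obtain ⟨δ, hδ, c₂, hc₂, t₁, hwall⟩ := hwall
  refine ⟨c₁ * δ / 48, by positivity, fun d => ?_⟩
  -- depth 0: there is no depth-0 proof of a negation
  rcases Nat.eq_zero_or_pos d with rfl | hdpos
  · refine ⟨0, ?_⟩
    intro n m E G _ _ _ _ π hπ
    exfalso
    have h := hπ.2 _ (List.mem_of_getLast? hπ.1.2)
    simp [PropForm.altDepth, PropForm.altDepthAux] at h
  -- the grid bound at depth `d + 23`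
  obtain ⟨n₁, hgrid⟩ := hgrid (d + 23)
  -- constants and thresholds for the depth `d ≥ 1`
  set D : ℝ := (d : ℝ) + 23 with hD
  set ε : ℝ := c₁ / D with hε
  have hD0 : 0 < D := by positivity
  have hε0 : 0 < ε := by positivity
  set b : ℝ := min 1 (c₂ / 6) with hb
  have hb0 : 0 < b := lt_min one_pos (by positivity)
  have hb1 : b ≤ 1 := min_le_left _ _
  have hb6 : 6 * b ≤ c₂ := by have := min_le_right 1 (c₂ / 6); linarith
  set κ : ℝ := b ^ (c₁ / 23) with hκ
  have hκ0 : 0 < κ := Real.rpow_pos_of_pos hb0 _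
  set Q : ℝ := max (max (n₁ : ℝ) 16) ((max 13 (36 / (ε * Real.log 2))) ^ (2 / ε)) with hQ
  have hQ16 : 16 ≤ Q := (le_max_right _ _).trans (le_max_left _ _)
  have hQ0 : 0 ≤ Q := by linarith
  set T : ℝ := max (max (t₁ : ℝ) 1) (max ((Q / b) ^ (1 / δ)) ((max 27 (6 / κ)) ^ (2 / (ε * δ))))
    with hT
  refine ⟨⌈T⌉₊, ?_⟩
  intro n m E G hcol hadj hconn htw π hπ
  -- unpack the threshold
  have hT' : T ≤ (treewidth G : ℝ) := Nat.ceil_le.1 htw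
  have ht₁ : t₁ ≤ treewidth G := by
    have : (t₁ : ℝ) ≤ treewidth G := ((le_max_left _ _).trans (le_max_left _ _)).trans hT'
    exact_mod_cast this
  have htw1 : (1 : ℝ) ≤ treewidth G := ((le_max_right _ _).trans (le_max_left _ _)).trans hT'
  have hTQ : (Q / b) ^ (1 / δ) ≤ treewidth G :=
    ((le_max_left _ _).trans (le_max_right _ _)).trans hT'
  have hTM : (max 27 (6 / κ)) ^ (2 / (ε * δ)) ≤ treewidth G :=
    ((le_max_right _ _).trans (le_max_right _ _)).trans hT'
  -- (W_δ): a wall, hence a brick graph, as a topological minor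
  obtain ⟨r, hr, hwallG⟩ := hwall (Fin m) G ht₁
  have htwδ : 0 ≤ (treewidth G : ℝ) ^ δ := Real.rpow_nonneg (by positivity) _
  have hbQ : Q ≤ b * (treewidth G : ℝ) ^ δ := TseitinNumerics.root_condition hb0 hδ hQ0 hTQ
  have hbr : 6 * (b * (treewidth G : ℝ) ^ δ) ≤ r :=
    calc 6 * (b * (treewidth G : ℝ) ^ δ) = (6 * b) * (treewidth G : ℝ) ^ δ := by ring
      _ ≤ c₂ * (treewidth G : ℝ) ^ δ := mul_le_mul_of_nonneg_right hb6 htwδ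
      _ ≤ r := hr
  have hr96 : 96 ≤ r := by
    have : (96 : ℝ) ≤ r := by linarith
    exact_mod_cast this
  set k : ℕ := (r - 3) / 3 with hk
  have hk3 : 3 * k + 3 ≤ r := by omega
  have hkr : r ≤ 6 * k := by omega
  have hkr' : (r : ℝ) ≤ 6 * k := by exact_mod_cast hkr
  have hbk : b * (treewidth G : ℝ) ^ δ ≤ k := by linarith
  have hkQ : Q ≤ k := hbQ.trans hbk
  obtain ⟨B⟩ := BrickEmbedding.nonempty_of_isTopologicalMinor
    (bricks_isTopologicalMinor (wall_isTopologicalMinor_of_le hk3 hwallG))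
  -- the reduction (§3.1–3.2): a refutation of the grid Tseitin formula
  obtain ⟨f, π', hπ', hsize⟩ := exists_gridRefutation ⟨hcol, hadj⟩ hconn B hπ
  -- (H′) applies to it
  have hkn₁ : n₁ ≤ k := by
    have : (n₁ : ℝ) ≤ k := ((le_max_left _ _).trans (le_max_left _ _)).trans hkQ
    exact_mod_cast this
  have hk16 : (16 : ℝ) ≤ k := hQ16.trans hkQ
  have hkM : (max 13 (36 / (ε * Real.log 2))) ^ (2 / ε) ≤ k := (le_max_right _ _).trans hkQ
  have hlow := hgrid k hkn₁ _ _ (gridSystem k f) (isGridTseitinSystem_gridSystem k f) π' hπ'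
  have hA : (2 : ℝ) ^ ((k : ℝ) ^ ε) ≤
      2 ^ (78 : ℕ) * ((proofSize π : ℝ) + (((k : ℝ) + 1) ^ 2 + 1)) ^ 3 := by
    have h1 : (proofSize π' : ℝ) ≤ 2 ^ (78 : ℕ) * ((proofSize π : ℝ) + ((k : ℝ) + 1) ^ 2 + 1) ^ 3 := by
      exact_mod_cast hsize
    have h2 : (2 : ℝ) ^ ((k : ℝ) ^ ε) ≤ proofSize π' := by
      have := hlow
      push_cast at this
      exact this
    rw [← add_assoc]
    exact h2.trans h1
  -- the polynomial term is negligible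
  have hP : ((k : ℝ) + 1) ^ 2 + 1 ≤ (2 : ℝ) ^ ((k : ℝ) ^ ε / 3 - 27) :=
    TseitinNumerics.poly_condition hε0 (by linarith) hkM
  -- the exponent comparison `tw^{c/d} ≤ k^ε/3 - 27`
  have hεle : ε ≤ c₁ / 23 := by
    rw [hε]
    exact div_le_div_of_nonneg_left hc₁.le (by norm_num)
      (by rw [hD]; linarith [(Nat.cast_nonneg d : (0 : ℝ) ≤ d)])
  have hκε : κ ≤ b ^ ε := Real.rpow_le_rpow_of_exponent_ge hb0 hb1 hεle
  have hkε : κ * (treewidth G : ℝ) ^ (ε * δ) ≤ (k : ℝ) ^ ε := by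
    have e1 : (treewidth G : ℝ) ^ (ε * δ) = ((treewidth G : ℝ) ^ δ) ^ ε := by
      rw [← Real.rpow_mul (by positivity), mul_comm]
    calc κ * (treewidth G : ℝ) ^ (ε * δ) ≤ b ^ ε * ((treewidth G : ℝ) ^ δ) ^ ε := by
          rw [e1]; exact mul_le_mul_of_nonneg_right hκε (Real.rpow_nonneg htwδ _)
      _ = (b * (treewidth G : ℝ) ^ δ) ^ ε := by rw [Real.mul_rpow hb0.le htwδ]
      _ ≤ (k : ℝ) ^ ε := Real.rpow_le_rpow (by positivity) hbk hε0.le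
  have hγ : c₁ * δ / 48 / (d : ℝ) ≤ ε * δ / 2 := by
    have hd1 : (1 : ℝ) ≤ d := by exact_mod_cast hdpos
    have hd0 : (0 : ℝ) < d := by linarith
    rw [hε, hD, div_le_iff₀ hd0]
    rw [show c₁ / ((d : ℝ) + 23) * δ / 2 * d = c₁ * δ * (d / (2 * ((d : ℝ) + 23))) by
      field_simp]
    have : (1 : ℝ) / 48 ≤ d / (2 * ((d : ℝ) + 23)) := by
      rw [div_le_div_iff₀ (by norm_num) (by positivity)]; linarith
    calc c₁ * δ / 48 = c₁ * δ * (1 / 48) := by ring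
      _ ≤ c₁ * δ * (d / (2 * ((d : ℝ) + 23))) := mul_le_mul_of_nonneg_left this (by positivity)
  have hB : (treewidth G : ℝ) ^ (c₁ * δ / 48 / (d : ℝ)) ≤ (k : ℝ) ^ ε / 3 - 27 :=
    (TseitinNumerics.exponent_condition' hκ0 hε0 hδ htw1 hγ hTM).trans (by linarith)
  -- conclude (§3.3)
  exact TseitinNumerics.size_condition (Nat.cast_nonneg _) (by positivity) hA hP hB

/-- Håstad's form (H) of the grid bound (uniform in `d ≤ K log n / log log n`) implies the
depth-by-depth form (H′) used above: for fixed `d` the side condition holds as soon as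
`n ≥ max 16 (exp ((2d/K)^2))` (`TseitinNumerics.depth_condition`). [folklore] -/
theorem gridBound_of_hastadForm
    (hgrid : ∃ K : ℝ, 0 < K ∧ ∃ c : ℝ, 0 < c ∧ ∃ n₀ : ℕ, ∀ n : ℕ, n₀ ≤ n → ∀ d : ℕ,
      (d : ℝ) ≤ K * Real.log n / Real.log (Real.log n) →
      ∀ (m v : ℕ) (E : Fin m → LinEqMod 2 v), IsGridTseitinSystem n E →
      ∀ π : List (PropForm ℕ),
        textbookFrege.IsDepthProofOf d π (neg (PropForm.ofCNF (sumEncoding 1 E))) →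
        (2 : ℝ) ^ ((n : ℝ) ^ (c / d)) ≤ (proofSize π : ℝ)) :
    ∃ c : ℝ, 0 < c ∧ ∀ d : ℕ, ∃ n₁ : ℕ, ∀ n : ℕ, n₁ ≤ n →
      ∀ (m v : ℕ) (E : Fin m → LinEqMod 2 v), IsGridTseitinSystem n E →
      ∀ π : List (PropForm ℕ),
        textbookFrege.IsDepthProofOf d π (neg (PropForm.ofCNF (sumEncoding 1 E))) →
        (2 : ℝ) ^ ((n : ℝ) ^ (c / d)) ≤ (proofSize π : ℝ) := by
  obtain ⟨K, hK, c, hc, n₀, hgrid⟩ := hgrid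
  refine ⟨c, hc, fun d => ?_⟩
  rcases Nat.eq_zero_or_pos d with rfl | hdpos
  · refine ⟨0, ?_⟩
    intro n _ m v E _ π hπ
    exfalso
    have h := hπ.2 _ (List.mem_of_getLast? hπ.1.2)
    simp [PropForm.altDepth, PropForm.altDepthAux] at h
  refine ⟨max n₀ ⌈max (16 : ℝ) (Real.exp ((2 * d / K) ^ 2))⌉₊, ?_⟩
  intro n hn m v E hE π hπ
  have hn₀ : n₀ ≤ n := (le_max_left _ _).trans hn
  have hn' : max (16 : ℝ) (Real.exp ((2 * d / K) ^ 2)) ≤ n := Nat.ceil_le.1 ((le_max_right _ _).trans hn)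
  have h16 : (16 : ℝ) ≤ n := (le_max_left _ _).trans hn'
  have hexp : Real.exp ((2 * d / K) ^ 2) ≤ n := (le_max_right _ _).trans hn'
  have hd0 : (0 : ℝ) < d := by exact_mod_cast hdpos
  exact hgrid n hn₀ d (TseitinNumerics.depth_condition hK hd0 h16 hexp) m v E hE π hπ

/-- The wall form (W) with GIRS's exponent `1/10` is the case `δ = 1/10` of (W_δ). [folklore] -/
theorem wallForm_anyExponent_of_tenth
    (hwall : ∃ c : ℝ, 0 < c ∧ ∃ t₁ : ℕ, ∀ (V : Type) [Fintype V] (G : SimpleGraph V),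
      t₁ ≤ treewidth G → ∃ r : ℕ, c * (treewidth G : ℝ) ^ (1 / 10 : ℝ) ≤ r ∧ wall r ≼ₜ G) :
    ∃ δ : ℝ, 0 < δ ∧ ∃ c : ℝ, 0 < c ∧ ∃ t₁ : ℕ, ∀ (V : Type) [Fintype V]
      (G : SimpleGraph V), t₁ ≤ treewidth G →
      ∃ r : ℕ, c * (treewidth G : ℝ) ^ δ ≤ r ∧ wall r ≼ₜ G :=
  ⟨1 / 10, by norm_num, hwall⟩

end Literature.Computability.MetaComplexity
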